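import Literature.Analysis.FluidPDE.NSLerayHopf
import Literature.Analysis.FluidPDE.LerayHopfProofs
import Literature.Analysis.FunctionSpaces.TestPairingLimits
import HarnessLib

/-!
# ns.S19: the hierarchy `W_LH ⊂ W_E` — Leray–Hopf non-uniqueness implies energy-class
  non-uniqueness

`Literature/Analysis/FluidPDE/NSLerayHopf.lean` records the two non-uniqueness problems for the
unforced Navier–Stokes system on `ℝ³` as named `Prop`s (**ns.S19**, both open in the refereed
literature the tree vendors):

* `Literature.Analysis.FluidPDE.LerayHopfNonUniqueness` — two global Leray–Hopf weak solutions
  from one weakly divergence-free datum `u₀ ∈ L²(ℝ³)`, distinct at some time `t > 0`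
  (Buckmaster–Vicol, EMS Surv. Math. Sci. 6, §3 after Thm. 3.7: "One may naturally ask if such
  non-uniqueness holds for Leray–Hopf weak solutions. This problem remains open."; §8, the
  Leray–Hopf uniqueness problem);
* `Literature.Analysis.FluidPDE.EnergyClassNonUniqueness` — two global weak solutions in the
  energy class `W_E = L^∞_t L²_x ∩ L²_t Ḣ¹_x` (accepted `Fluid.IsWeakNSSolutionOn` on every
  `[0, T)` plus `MemEnergyClass`, no energy inequality), distinct a.e. in space–time
  (Buckmaster–Vicol, Ann. of Math. 189, §1.2, the paragraph after Thm. 1.2: the `C⁰_t H^β_x`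
  solutions of Thm. 1.2 "do not obey the energy inequality or have `L²_t Ḣ¹_x`
  integrability" — non-uniqueness in `W_E` is *not* proved there).

This file **proves** the implication between them,
`energyClassNonUniqueness_of_lerayHopfNonUniqueness : LerayHopfNonUniqueness →
EnergyClassNonUniqueness`, i.e. the elementary inclusion of solution classes behind
Buckmaster–Vicol's hierarchy (EMS Surv. 6, §2: "the so-called energy space
`L^∞_t L²_x ∩ L²_t H¹_x`", "a weak solution `v^ν` in the energy class"; Def. 3.5: the Leray–Hopf
class is the part of it obeying the energy inequality): a Leray–Hopf solution is a weak solution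
lying in `L^∞_t L²_x ∩ L²_t Ḣ¹_x` (`memEnergyClass_of_isLerayHopfOn`, already in `NSLerayHopf`),
and — the one point needing an argument, because the two `Prop`s phrase *distinctness*
differently — two global Leray–Hopf
solutions of the same problem which agree a.e. in space–time on `(0, ∞) × E` agree slice-wise
at **every** positive time (`IsGlobalLerayHopf.ae_eq_slice_of_uncurry_ae_eq`): by Fubini they
agree slice-wise for a.e. `t > 0`; the weak `L²` continuity clause of `Fluid.IsLerayHopfOn`
makes `t ↦ ∫ ⟪u(t), w⟫` and `t ↦ ∫ ⟪v(t), w⟫` continuous on `(0, T]` for every `w ∈ L²`, so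
they agree on all of `(0, T]` (`Measure.eqOn_Ioc_of_ae_eq`); and two `L²` slices with the same
pairings against all test fields coincide a.e. (du Bois-Reymond,
`ae_eq_of_forall_integral_inner_test_eq`). Hence slice-wise distinctness at one time `t > 0`
(the clause of `LerayHopfNonUniqueness`) yields distinctness a.e. in space–time (the clause of
`EnergyClassNonUniqueness`).

## Status of the two problems (literature check, 2026-08)

Neither `Prop` is discharged here, and neither can be from the sources the tree vendors: both
are open problems there (Buckmaster–Vicol 2019, loc. cit.; EMS Surv. 6, §8). For the record:
Hou–Wang–Yang, arXiv:2509.25116 (2025), Thm. 1, announce a *computer-assisted* proof that the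
unforced system on `ℝ³ × [0, 1]` admits infinitely many distinct suitable Leray–Hopf solutions
from one compactly supported divergence-free datum `u_in ∈ L^q`, `q < 3` (rigorous verification
of an unstable eigenvalue of the linearisation at a numerically constructed self-similar
profile, then the Jia–Šverák / Albritton–Brué–Colombo bifurcation argument). Combined with the
continuation of Leray–Hopf solutions on `[0, 1)` to global ones and with the implication proved
here, that result would settle both `Prop`s; it is a preprint (unrefereed as of 2026-08) and
nothing in this file depends on it [claim: HouWangYang2025, Thm. 1, status: preprint,
computer-assisted].

## Contents

* `ae_restrict_Ioi_slice_ae_eq_of_uncurry_ae_eq` — Fubini: a.e. equality on `(0, ∞) × E` is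
  slice-wise a.e. equality for a.e. `t > 0` (real proof).
* `IsGlobalLerayHopf.integral_inner_eq_of_uncurry_ae_eq` — equal pairings `∫ ⟪u(t), w⟫ =
  ∫ ⟪v(t), w⟫` for every `t > 0`, `w ∈ L²` (real proof, weak continuity).
* `IsGlobalLerayHopf.ae_eq_slice_of_uncurry_ae_eq` — slice-wise equality at every `t > 0`
  (real proof).
* `energyClassNonUniqueness_of_lerayHopfNonUniqueness`,
  `LerayHopfNonUniqueness.energyClassNonUniqueness` — the implication (real proof).

## References

* T. Buckmaster, V. Vicol, *Nonuniqueness of weak solutions to the Navier–Stokes equation*,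
  Ann. of Math. 189 (2019), 101–144, Def. 1.1, Thm. 1.2 and §1.2 (p. 4 of arXiv:1709.10033).
* T. Buckmaster, V. Vicol, *Convex integration and phenomenologies in turbulence*, EMS Surv.
  Math. Sci. 6 (2019/2020), 173–263, Defs. 3.5–3.6, Thm. 3.7, §8.
* T. Y. Hou, Y. Wang, C. Yang, *Nonuniqueness of Leray–Hopf solutions to the unforced
  incompressible 3D Navier–Stokes equation*, arXiv:2509.25116 (2025), Thm. 1 (preprint,
  computer-assisted).
* J. Leray, Acta Math. 63 (1934), §31 (weak continuity in `L²` of solutions turbulentes).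
-/

noncomputable section

open MeasureTheory TopologicalSpace Set Function Filter Topology
open scoped InnerProductSpace RealInnerProductSpace ENNReal NNReal

namespace Literature.Analysis.FluidPDE

section Fubini

variable {X : Type*} [MeasureSpace X] [SFinite (volume : Measure X)] {F : Type*}

/-- **Fubini for space–time a.e. equality.** If two time-dependent fields agree a.e. on
`(0, ∞) × X` (product measure `vol ⊗ vol` restricted to the slab), then for a.e. `t > 0` their
slices agree a.e. in space (`Measure.ae_ae_of_ae_prod` for
`vol|_{(0,∞) × X} = (vol|_{(0,∞)}) ⊗ vol`). [folklore] -/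
theorem ae_restrict_Ioi_slice_ae_eq_of_uncurry_ae_eq {u v : ℝ → X → F}
    (h : uncurry u =ᵐ[volume.restrict (Ioi (0 : ℝ) ×ˢ (univ : Set X))] uncurry v) :
    ∀ᵐ t ∂(volume.restrict (Ioi (0 : ℝ))), u t =ᵐ[volume] v t := by
  have hμ : (volume.restrict (Ioi (0 : ℝ) ×ˢ (univ : Set X)) : Measure (ℝ × X)) =
      (volume.restrict (Ioi (0 : ℝ))).prod (volume : Measure X) := by
    rw [Measure.volume_eq_prod, ← Measure.restrict_univ (μ := (volume : Measure X)),
      Measure.prod_restrict, Measure.restrict_univ]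
  rw [EventuallyEq, hμ] at h
  filter_upwards [Measure.ae_ae_of_ae_prod h] with t ht
  filter_upwards [ht] with x hx
  exact hx

end Fubini

section General

variable {E : Type*} [NormedAddCommGroup E] [InnerProductSpace ℝ E] [FiniteDimensional ℝ E]
  [MeasurableSpace E] [BorelSpace E]
variable {ν : ℝ} {f : ℝ → E → E} {u₀ : E → E} {u v : ℝ → E → E}

/-- **Equal pairings at every positive time.** Two global Leray–Hopf solutions (same viscosity,
force and datum) which agree a.e. in space–time on `(0, ∞) × E` have the same pairings
`∫ ⟪u(t), w⟫ = ∫ ⟪v(t), w⟫` against every `w ∈ L²`, for **every** `t > 0`: the two pairings are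
continuous on `(0, t]` (weak `L²` continuity clause of `Fluid.IsLerayHopfOn`, Leray 1934, §31)
and agree for a.e. `s ∈ (0, t]` (Fubini), hence everywhere on `(0, t]`
(`Measure.eqOn_Ioc_of_ae_eq`). [folklore] -/
theorem IsGlobalLerayHopf.integral_inner_eq_of_uncurry_ae_eq
    (hu : IsGlobalLerayHopf ν f u₀ u) (hv : IsGlobalLerayHopf ν f u₀ v)
    (h : uncurry u =ᵐ[volume.restrict (Ioi (0 : ℝ) ×ˢ (univ : Set E))] uncurry v)
    {t : ℝ} (ht : 0 < t) {w : E → E} (hw : MemLp w 2 volume) :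
    ∫ x, ⟪u t x, w x⟫ = ∫ x, ⟪v t x, w x⟫ := by
  have hae := ae_restrict_Ioi_slice_ae_eq_of_uncurry_ae_eq h
  have hcu := ((hu t ht).weak_continuous w hw).1
  have hcv := ((hv t ht).weak_continuous w hw).1
  have haet : (fun s => ∫ x, ⟪u s x, w x⟫) =ᵐ[volume.restrict (Ioc 0 t)]
      fun s => ∫ x, ⟪v s x, w x⟫ := by
    have h1 : ∀ᵐ s ∂(volume.restrict (Ioc 0 t)), u s =ᵐ[volume] v s :=
      ae_restrict_of_ae_restrict_of_subset Ioc_subset_Ioi_self hae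
    filter_upwards [h1] with s hs
    refine integral_congr_ae ?_
    filter_upwards [hs] with x hx
    rw [hx]
  exact Measure.eqOn_Ioc_of_ae_eq (μ := volume) haet hcu hcv ⟨ht, le_rfl⟩

/-- **Space–time a.e. equality of global Leray–Hopf solutions is slice-wise equality at every
positive time.** If two global Leray–Hopf weak solutions of the same problem agree a.e. on
`(0, ∞) × E`, then `u(t) = v(t)` a.e. in space for every `t > 0`: the slices `u(t)`, `v(t)` lie
in `L²` (field `memLp` of `Fluid.IsLerayHopfOn`), have the same pairings against every `L²`
field (`integral_inner_eq_of_uncurry_ae_eq`), in particular against every smooth compactly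
supported field, and so coincide a.e. (du Bois-Reymond,
`ae_eq_of_forall_integral_inner_test_eq`). This is the step relating the distinctness clauses of
`LerayHopfNonUniqueness` (one slice) and `EnergyClassNonUniqueness` (space–time a.e.); weak
continuity in `L²` is Leray 1934, §31. [folklore] -/
theorem IsGlobalLerayHopf.ae_eq_slice_of_uncurry_ae_eq
    (hu : IsGlobalLerayHopf ν f u₀ u) (hv : IsGlobalLerayHopf ν f u₀ v)
    (h : uncurry u =ᵐ[volume.restrict (Ioi (0 : ℝ) ×ˢ (univ : Set E))] uncurry v)
    {t : ℝ} (ht : 0 < t) : u t =ᵐ[volume] v t := by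
  have hut : MemLp (u t) 2 volume := (hu t ht).memLp t ⟨ht.le, le_rfl⟩
  have hvt : MemLp (v t) 2 volume := (hv t ht).memLp t ⟨ht.le, le_rfl⟩
  refine FunctionSpaces.ae_eq_of_forall_integral_inner_test_eq
    (hut.locallyIntegrable one_le_two) (hvt.locallyIntegrable one_le_two) fun φ hφ => ?_
  exact hu.integral_inner_eq_of_uncurry_ae_eq hv h ht
    (hφ.contDiff.continuous.memLp_of_hasCompactSupport hφ.hasCompactSupport)

/-- Contrapositive form: two global Leray–Hopf solutions of the same problem which differ on a
set of positive measure at one time `t > 0` differ on a set of positive space–time measure in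
`(0, ∞) × E`. [folklore] -/
theorem IsGlobalLerayHopf.not_uncurry_ae_eq_of_not_ae_eq_slice
    (hu : IsGlobalLerayHopf ν f u₀ u) (hv : IsGlobalLerayHopf ν f u₀ v)
    {t : ℝ} (ht : 0 < t) (hne : ¬ (u t =ᵐ[volume] v t)) :
    ¬ (uncurry u =ᵐ[volume.restrict (Ioi (0 : ℝ) ×ˢ (univ : Set E))] uncurry v) :=
  fun h => hne (hu.ae_eq_slice_of_uncurry_ae_eq hv h ht)

end General

/-! ### The implication `LerayHopfNonUniqueness → EnergyClassNonUniqueness` -/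

/-- **Leray–Hopf non-uniqueness implies energy-class non-uniqueness** (the inclusion
`W_LH ⊂ W_E` of Buckmaster–Vicol's hierarchy of weak-solution classes, EMS Surv. Math. Sci. 6,
§2 (energy class), Def. 3.5 (Leray–Hopf class) and §8; Ann. of Math. 189, §1.2). If some `ν > 0` and some weakly divergence-free
`u₀ ∈ L²(ℝ³)` admit two global Leray–Hopf weak solutions of the unforced system distinct at
some time `t > 0` (`LerayHopfNonUniqueness`, **ns.S19**), then the same `ν`, `u₀`, `u`, `v`
witness `EnergyClassNonUniqueness`: each is a weak solution on every `[0, T)` (field `weak`)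
lying in `L^∞(0,T; L²) ∩ L²(0,T; Ḣ¹)` (`memEnergyClass_of_isLerayHopfOn`), and they are distinct
a.e. in space–time by `IsGlobalLerayHopf.ae_eq_slice_of_uncurry_ae_eq`. Real proof; both
`Prop`s remain open problems in the cited sources (see the module docstring for the 2025
computer-assisted claim of Hou–Wang–Yang). [cite: BuckmasterVicol2020, §2, Def. 3.5, §8] [cite: BuckmasterVicol2019AnnMath, §1.2 after Thm. 1.2] -/
theorem energyClassNonUniqueness_of_lerayHopfNonUniqueness (h : LerayHopfNonUniqueness) :
    EnergyClassNonUniqueness := by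
  obtain ⟨ν, hν, u₀, hu₀, hdiv, u, v, hu, hv, t, ht, hne⟩ := h
  exact ⟨ν, hν, u₀, hu₀, hdiv, u, v,
    fun T hT => ⟨(hu T hT).weak, memEnergyClass_of_isLerayHopfOn (hu T hT)⟩,
    fun T hT => ⟨(hv T hT).weak, memEnergyClass_of_isLerayHopfOn (hv T hT)⟩,
    IsGlobalLerayHopf.not_uncurry_ae_eq_of_not_ae_eq_slice hu hv ht hne⟩

/-- Dot-notation alias of `energyClassNonUniqueness_of_lerayHopfNonUniqueness`: Leray–Hopf
non-uniqueness (**ns.S19**, `W_LH`) implies energy-class non-uniqueness (`W_E`). [cite: BuckmasterVicol2020, §2, Def. 3.5, §8] -/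
theorem LerayHopfNonUniqueness.energyClassNonUniqueness (h : LerayHopfNonUniqueness) :
    EnergyClassNonUniqueness :=
  energyClassNonUniqueness_of_lerayHopfNonUniqueness h

end Literature.Analysis.FluidPDE
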